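import Literature.AlgebraicGeometry.ModuliOfAbelianVarieties.SiegelComplexRecordSystem
import HarnessLib

/-!
# The principal congruence subgroups `K_δ(N)` are normal in `K_δ(1) = GSp_δ(ℤ̂)`

Topic `Literature/AlgebraicGeometry/ModuliOfAbelianVarieties` (proofs only; no definitions, no named facts),
over ★ (σ3) `SiegelComplexRecordSystem` (`levelIdeal N = N·𝓞̂`, `IsCongOne N A` «`A ≡ 1 (mod N·𝓞̂)` entrywise»,
`principalLevelSubgroup δ N = K_δ(N) = {γ ∈ GSp_δ(𝔸_f) | γ ≡ 1, γ⁻¹ ≡ 1 (mod N)}`):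

* `isIntegral_of_isCongOne_one` — `A ≡ 1 (mod 𝓞̂)` means `A` has integral entries;
* `IsCongOne.conj` — `A ≡ 1 (mod N)` and `P, Q` integral with `P Q = 1` give `P A Q ≡ 1 (mod N)`
  (`P A Q − 1 = P (A − 1) Q` and `𝓞̂ · N𝓞̂ · 𝓞̂ ⊆ N𝓞̂`);
* `principalLevelSubgroup_normal_in_one` — **`γ K_δ(N) γ⁻¹ = K_δ(N)` for `γ ∈ K_δ(1)`**, and the packaged
  `principalLevelSubgroup_subgroupOf_one_normal : ((K_δ(N)).subgroupOf (K_δ(1))).Normal`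
  (`K(N)` is the kernel of `GSp_δ(ℤ̂) → GL_{2g}(ℤ/N)`; Deligne, *Travaux de Shimura*, Exemple 4.16; Milne,
  *Introduction to Shimura varieties*, §6 p. 70 / Lemma 5.13).

Cell `hodgecm-mathlib`, fan B (T3) receptacle `F1ExtHodgeType` v4, leaf Q6b-(iv) «normality» (binder of
`stub_frame` / `stub_Squot` in B-plan2's v4 probe).

## Sources

* P. Deligne, *Travaux de Shimura*, Sém. Bourbaki 389 (1971), Exemple 4.16 p. 150. [Deligne1971TravauxShimura]
* J. S. Milne, *Introduction to Shimura varieties* (2005), §6 p. 70, Lemma 5.13 p. 57. [Milne2005ShimuraVarieties]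
-/

set_option autoImplicit false

noncomputable section

open Matrix NumberField IsDedekindDomain

namespace Literature.AlgebraicGeometry.ModuliOfAbelianVarieties

variable {g : ℕ}

/-! ### Congruence `≡ 1 (mod N)` under conjugation by integral matrices -/

section Congruence

variable {n : Type} [Fintype n] [DecidableEq n]

omit [Fintype n] in
/-- `A ≡ 1 (mod 1·𝓞̂)` says exactly that `A` has entries in `𝓞̂`. [cite: Deligne1971TravauxShimura, Exemple 4.16 p. 150] -/
theorem isIntegral_of_isCongOne_one {A : Matrix n n finAdeleQ} (hA : IsCongOne 1 A) (i j : n) :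
    A i j ∈ FiniteAdeleRing.integralAdeles (𝓞 ℚ) ℚ := by
  have h1 : (A - 1) i j ∈ FiniteAdeleRing.integralAdeles (𝓞 ℚ) ℚ :=
    mem_integralAdeles_of_mem_levelIdeal (hA i j)
  have h2 : (1 : Matrix n n finAdeleQ) i j ∈ FiniteAdeleRing.integralAdeles (𝓞 ℚ) ℚ := by
    rw [Matrix.one_apply]
    split_ifs
    · exact one_mem _
    · exact zero_mem _
  have : A i j = (A - 1) i j + (1 : Matrix n n finAdeleQ) i j := by
    rw [Matrix.sub_apply, sub_add_cancel]
  rw [this]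
  exact add_mem h1 h2

/-- **Conjugation by integral matrices preserves `≡ 1 (mod N)`**: if `A ≡ 1 (mod N·𝓞̂)` and `P, Q` have
integral entries with `P Q = 1`, then `P A Q ≡ 1 (mod N·𝓞̂)` (`P A Q − 1 = P (A − 1) Q`).
[cite: Deligne1971TravauxShimura, Exemple 4.16 p. 150] -/
theorem IsCongOne.conj {N : ℕ} {A P Q : Matrix n n finAdeleQ} (hA : IsCongOne N A)
    (hP : ∀ i j, P i j ∈ FiniteAdeleRing.integralAdeles (𝓞 ℚ) ℚ)
    (hQ : ∀ i j, Q i j ∈ FiniteAdeleRing.integralAdeles (𝓞 ℚ) ℚ) (hPQ : P * Q = 1) :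
    IsCongOne N (P * A * Q) := by
  intro i j
  have h : P * A * Q - 1 = P * (A - 1) * Q := by
    rw [Matrix.mul_sub, Matrix.sub_mul, Matrix.mul_one, hPQ]
  rw [h, Matrix.mul_apply]
  refine sum_mem fun m _ => ?_
  rw [Matrix.mul_apply, Finset.sum_mul]
  refine sum_mem fun l _ => ?_
  -- `P i l · (A - 1) l m · Q m j ∈ N·𝓞̂`
  rw [mul_comm (P i l) ((A - 1) l m), mul_assoc, mul_comm]
  exact mul_mem_levelIdeal_of_mem_integralAdeles (Subring.mul_mem _ (hP i l) (hQ m j)) (hA l m)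

end Congruence

/-! ### Normality of `K_δ(N)` in `K_δ(1)` -/

section Levels

variable (δ : Fin g → ℕ)

/-- **`K_δ(N)` is normalised by `K_δ(1) = GSp_δ(ℤ̂)`**: for `γ ∈ K_δ(1)` (so `γ, γ⁻¹` are `ℤ̂`-integral) and
`k ∈ K_δ(N)`, `γ k γ⁻¹ ∈ K_δ(N)` — `K(N)` is the kernel of reduction `GSp_δ(ℤ̂) → GL_{2g}(ℤ/N)`.
[cite: Deligne1971TravauxShimura, Exemple 4.16 p. 150] [cite: Milne2005ShimuraVarieties, §6 p. 70] -/
theorem principalLevelSubgroup_normal_in_one (N : ℕ) {γ k : gspFinAdelic δ}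
    (hγ : γ ∈ principalLevelSubgroup δ 1) (hk : k ∈ principalLevelSubgroup δ N) :
    γ * k * γ⁻¹ ∈ principalLevelSubgroup δ N := by
  rw [mem_principalLevelSubgroup_iff] at hγ hk ⊢
  have hγi := isIntegral_of_isCongOne_one hγ.1
  have hγi' := isIntegral_of_isCongOne_one hγ.2
  have hPQ : ((γ : GL (Fin g ⊕ Fin g) finAdeleQ) : Matrix (Fin g ⊕ Fin g) (Fin g ⊕ Fin g) finAdeleQ) *
      (((γ : GL (Fin g ⊕ Fin g) finAdeleQ)⁻¹ : GL (Fin g ⊕ Fin g) finAdeleQ) :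
        Matrix (Fin g ⊕ Fin g) (Fin g ⊕ Fin g) finAdeleQ) = 1 :=
    Units.mul_inv _
  refine ⟨?_, ?_⟩
  · have h1 := hk.1.conj hγi hγi' hPQ
    have e : (((γ * k * γ⁻¹ : gspFinAdelic δ) : GL (Fin g ⊕ Fin g) finAdeleQ) :
          Matrix (Fin g ⊕ Fin g) (Fin g ⊕ Fin g) finAdeleQ) =
        ((γ : GL (Fin g ⊕ Fin g) finAdeleQ) : Matrix (Fin g ⊕ Fin g) (Fin g ⊕ Fin g) finAdeleQ) *
          ((k : GL (Fin g ⊕ Fin g) finAdeleQ) : Matrix (Fin g ⊕ Fin g) (Fin g ⊕ Fin g) finAdeleQ) *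
          (((γ : GL (Fin g ⊕ Fin g) finAdeleQ)⁻¹ : GL (Fin g ⊕ Fin g) finAdeleQ) :
            Matrix (Fin g ⊕ Fin g) (Fin g ⊕ Fin g) finAdeleQ) := by
      simp only [Subgroup.coe_mul, Subgroup.coe_inv, Units.val_mul]
    rw [e]
    exact h1
  · have h2 := hk.2.conj hγi hγi' hPQ
    have e : ((((γ * k * γ⁻¹ : gspFinAdelic δ) : GL (Fin g ⊕ Fin g) finAdeleQ)⁻¹ :
          GL (Fin g ⊕ Fin g) finAdeleQ) : Matrix (Fin g ⊕ Fin g) (Fin g ⊕ Fin g) finAdeleQ) =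
        ((γ : GL (Fin g ⊕ Fin g) finAdeleQ) : Matrix (Fin g ⊕ Fin g) (Fin g ⊕ Fin g) finAdeleQ) *
          (((k : GL (Fin g ⊕ Fin g) finAdeleQ)⁻¹ : GL (Fin g ⊕ Fin g) finAdeleQ) :
            Matrix (Fin g ⊕ Fin g) (Fin g ⊕ Fin g) finAdeleQ) *
          (((γ : GL (Fin g ⊕ Fin g) finAdeleQ)⁻¹ : GL (Fin g ⊕ Fin g) finAdeleQ) :
            Matrix (Fin g ⊕ Fin g) (Fin g ⊕ Fin g) finAdeleQ) := by
      simp only [Subgroup.coe_mul, Subgroup.coe_inv, _root_.mul_inv_rev, inv_inv, Units.val_mul,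
        mul_assoc]
    rw [e]
    exact h2

/-- **`K_δ(N) ⊴ K_δ(1)`**, packaged: the subgroup `K_δ(N) ∩ K_δ(1)` of `K_δ(1)` (= `K_δ(N)` viewed inside `K_δ(1)`,
Mathlib `Subgroup.subgroupOf`) is normal. [cite: Milne2005ShimuraVarieties, §6 p. 70] -/
theorem principalLevelSubgroup_subgroupOf_one_normal (N : ℕ) :
    ((principalLevelSubgroup δ N).subgroupOf (principalLevelSubgroup δ 1)).Normal := by
  refine ⟨fun k hk γ => ?_⟩
  rw [Subgroup.mem_subgroupOf] at hk ⊢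
  simp only [Subgroup.coe_mul, Subgroup.coe_inv]
  exact principalLevelSubgroup_normal_in_one δ N γ.2 hk

end Levels

end Literature.AlgebraicGeometry.ModuliOfAbelianVarieties

end
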